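import Summits.QuantumFields.QCD.Theses.GapBuysCauchyRate

/-!
# Stub `stub_chiralOfLightSeq` of line `birth` for crux `GapBuysCauchyRate.LadderCauchyRate`
(item stmt-QuantumFields-17307, route route-QuantumFields-GapBuysCauchyRate, sub-problem QCD)

What is proved: the MINIMAL (sequential) CHIRAL TRANSFER LEMMA (S4″). If a regularisation `reg`
carries a "sequential light pseudoscalar" — a rate function `μ` on positive mass tuples with
`μ m < ε` available for every `ε > 0`, and at every positive `m` ONE pair of local observables
`A, B`, a constant `c > 0` and lattice times `n_k ≤ L_k` (eventually) with `a_k n_k → ∞`, such that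
the connected correlator on the scheme's OWN torus `2L_k+1` at time `n_k` is bounded BELOW by
`c·exp(−μ(m)·a_k·n_k)` eventually in `k` — then `reg.IsChiralAtZero`.

Proof outline (pure real analysis on the two definitions `QCDRegularisation.IsChiralAtZero`,
`QCDScheme.HasLatticeMassGap`; the fields `L`, `a`, `β` of `reg.scheme m 0 0` are those of `reg` by
`rfl`): given `ε > 0` pick `m > 0` with `μ m < ε`; if `reg.scheme m 0 0` had the uniform gap `ε`, the
gap clause for the pair `(A, B)` gives `C` and an eventual-in-`k` UPPER bound; specialised at
`S = L_k`, `n = n_k ≤ L_k` it reads `‖corr_k(n_k)‖ ≤ C·exp(−ε·a_k·n_k)`. Intersecting the three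
eventual sets, `c·exp(−μ a_k n_k) ≤ C·exp(−ε a_k n_k)` eventually, while
`C·exp(−(ε−μ) a_k n_k) → 0 < c` because `(ε − μ m) > 0` and `a_k n_k → ∞`; multiplying the latter
strict inequality by `exp(−μ a_k n_k) > 0` contradicts the former at one common `k`.
Sources: Mathlib filter/`Real.exp` asymptotics only.

Pure theorem file (no definitions): the registered stub signature, proved in tree vocabulary.
-/

noncomputable section

namespace Summit.QuantumFields.QCD.Cruxes.LadderCauchyRate.Birth

open scoped BigOperators Topology
open MeasureTheory Filter
open Literature.MathematicalPhysics.AQFT Literature.Probability.LatticeModels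
  Literature.MathematicalPhysics.QuantumLattice Literature.MathematicalPhysics.QuantumFieldTheory
open Summit.QuantumFields.QCD.Theses.GapBuysCauchyRate

/-- Splitting an exponential decay rate: `e^{-(ε-μ)y} · e^{-μ y} = e^{-ε y}`. -/
private theorem exp_neg_sub_mul_mul_exp_neg_mul_seq (ε μ y : ℝ) :
    Real.exp (-((ε - μ) * y)) * Real.exp (-(μ * y)) = Real.exp (-(ε * y)) := by
  rw [← Real.exp_add]
  congr 1
  ring

/-- The elementary contradiction behind the sequential chiral transfer: along any real sequence
`t_k → ∞`, a positive constant `c` cannot satisfy `c·e^{-μ t_k} ≤ C·e^{-ε t_k}` frequently when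
`μ < ε` (then `c ≤ C·e^{-(ε-μ) t_k} → 0`). Stated as: the eventual sandwich forces `c ≤ 0`. -/
private theorem not_pos_of_eventually_sandwich_seq {c C ε μ : ℝ} {t : ℕ → ℝ}
    (ht : Tendsto t atTop atTop) (hμε : μ < ε)
    (h : ∀ᶠ k in atTop, c * Real.exp (-(μ * t k)) ≤ C * Real.exp (-(ε * t k))) :
    c ≤ 0 := by
  refine le_of_not_gt fun hc => ?_
  have h1 : Tendsto (fun k => (ε - μ) * t k) atTop atTop := ht.const_mul_atTop (sub_pos.2 hμε)
  have h2 : Tendsto (fun k => C * Real.exp (-((ε - μ) * t k))) atTop (𝓝 (C * 0)) :=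
    (Real.tendsto_exp_neg_atTop_nhds_zero.comp h1).const_mul C
  rw [mul_zero] at h2
  have hlt : ∀ᶠ k in atTop, C * Real.exp (-((ε - μ) * t k)) < c := h2.eventually (gt_mem_nhds hc)
  obtain ⟨k, hle, hltk⟩ := (h.and hlt).exists
  have hpos : 0 < Real.exp (-(μ * t k)) := Real.exp_pos _
  have hlt' := mul_lt_mul_of_pos_right hltk hpos
  rw [mul_assoc, exp_neg_sub_mul_mul_exp_neg_mul_seq] at hlt'
  exact absurd (hle.trans_lt hlt') (lt_irrefl _)

/-- (S4″) chiral transfer from the SEQUENTIAL light pseudoscalar (size S, provable now).  Registered in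
tree vocabulary (= `ChiralTransferSeqStmt` with `HasLightPseudoscalarSeq` written out): a lower bound
`c e^{−μ(m) a_k n_k}` on one connected lattice correlator on the scheme's own torus, at one lattice
time `n_k ≤ L_k` per step with `a_k n_k → ∞` and `μ(m) → 0` as `m → 0⁺`, kills every uniform lattice
gap `ε > 0` at some positive mass tuple. -/
theorem stub_chiralOfLightSeq :
    ∀ (Nf : ℕ) (reg : QCDRegularisation Nf),
      (∃ μ : (Fin Nf → ℝ) → ℝ,
        (∀ ε > (0 : ℝ), ∃ m : Fin Nf → ℝ, (∀ f, 0 < m f) ∧ μ m < ε) ∧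
        ∀ m : Fin Nf → ℝ, (∀ f, 0 < m f) →
          ∃ (R R' : ℕ) (A : QCDLatticeObservable Nf R) (B : QCDLatticeObservable Nf R') (c : ℝ) (nseq : ℕ → ℕ),
            0 < c ∧ (∀ᶠ k in Filter.atTop, nseq k ≤ reg.L k) ∧
            Filter.Tendsto (fun k => reg.a k * nseq k) Filter.atTop Filter.atTop ∧
            ∀ᶠ k in Filter.atTop,
              c * Real.exp (-(μ m * (reg.a k * nseq k))) ≤
                ‖qcdLatticeConnectedCorr (reg.β k) (2 * reg.L k + 1) (fun fl => (reg.scheme m 0 0).mq fl k)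
                  A B (nseq k)‖) →
      reg.IsChiralAtZero := by
  intro Nf reg hlight ε hε
  obtain ⟨μ, hsmall, hlow⟩ := hlight
  obtain ⟨m, hm, hμε⟩ := hsmall ε hε
  refine ⟨m, hm, fun hgap => ?_⟩
  obtain ⟨R, R', A, B, c, nseq, hc, hnL, htend, hev⟩ := hlow m hm
  obtain ⟨C, hC⟩ := hgap R R' A B
  have hsand : ∀ᶠ k in atTop,
      c * Real.exp (-(μ m * (reg.a k * nseq k))) ≤ C * Real.exp (-(ε * (reg.a k * nseq k))) := by
    filter_upwards [hnL, hev, hC] with k hk₁ hk₂ hk₃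
    have hup : ‖qcdLatticeConnectedCorr (reg.β k) (2 * reg.L k + 1)
        (fun fl => (reg.scheme m 0 0).mq fl k) A B (nseq k)‖ ≤
          C * Real.exp (-(ε * (reg.a k * nseq k))) :=
      hk₃ (reg.L k) le_rfl (nseq k) hk₁
    exact hk₂.trans hup
  exact absurd (not_pos_of_eventually_sandwich_seq htend hμε hsand) (not_le.2 hc)

end Summit.QuantumFields.QCD.Cruxes.LadderCauchyRate.Birth

end
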